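import Mathlib
import Summits.CriticalPhenomena.PercolationContinuityZ3.Theorems.PercNearOneGluingNoHeavyLowerTailStairKernels
import Summits.CriticalPhenomena.PercolationContinuityZ3.Theorems.PercNearOneGluingNoHeavyLowerTailHurwitzPairPivots
import HarnessLib

/-!
# CONJECTURE R at the mixed vertex of the T′ = 2 cube: one neutral and one classical copy

Support file for the Sahi / Conjecture-P programme of route `PercNearOneGluingNoHeavy`
(`--supports stmt-CriticalPhenomena-4575`, prover prim-l12-p5 gen 50; proof note
`prim-l12-p5/PROOF-DRIFTING-HURWITZ-g50.md` §3, §6).  No definitions, no named facts, no sorries.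

At the vertex `g = (1, 0)` of the sub-neutral square the λ-free band matrix is (FACTORIZATION THEOREM, g47 §2.6)
`W = (1/q)(Θ_b + q)·(I + β D)` — an ordered product of a neutral factor `Θ_b + r = bD + N̂ + r` and a CLASSICAL
factor `βD + ρ`; in the language of CONJECTURE R^prod this is the limit of infinite second gap.  Its bands are
`κ₀(k) = ρ(k + r)`, `κ₁(k) = k(β(k + r) + bρ)`, `κ₂(k) = bβk(k-1)`, and the operator Hurwitz matrix is the doubled
kernel `t = 2k ↦ W(k,·)`, `t = 2k+1 ↦ C(k,·)`, `C(k,l) = W(k+1,l) - W(k,l-1)`.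

**THEOREM (`neutralClassical_hurwitz_tn`).**  For `b, β, r, ρ > 0` this kernel is totally nonnegative — with
NO gap condition.  Proof = the five-stage elimination of `…LowerTailTwoFactorHurwitzTN` (same multipliers
`k/2`, `4bβ/K` with `K = bρ + β(1+r)`, `a1lo/𝒞`, `𝒞/ŵ`, `ŵ/D₀`), now with
`K𝒞(k) = 2β²(r+1)k + (bρ - β(r+1))² + 4bβρ` and `ŵ(k+1)·K𝒞(k) = ρ·𝒫(k)`,
`𝒫(k) = r(bρ - β(k+r))² + β²(k+r)(k+2r+1) > 0` (`keyPivot_pos`).  Together with `neutral_hurwitz_tn` (vertex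
`(1,1)`), `ClassicalVertex.classical_hurwitz_tn` (vertex `(0,0)`) and `HurwitzPair.hurwitzPair_tn` (the open
square) this puts CONJECTURE R for `T′ = 2` in the kernel on the whole closed square except the identical
neutral diagonal point.
-/

namespace Summit.CriticalPhenomena.PercolationContinuityZ3.Theorems

namespace NeutralClassical

open Finset Matrix

/-- **The key pivot.**  `𝒫(k) = r(bρ - β(k+r))² + β²(k+r)(k+2r+1) > 0` for `k ≥ 0`. -/
theorem keyPivot_pos (b β r ρ k : ℝ) (hβ : 0 < β) (hr : 0 < r) (hk : 0 ≤ k) :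
    0 < r * (b * ρ - β * (k + r)) ^ 2 + β ^ 2 * ((k + r) * (k + 2 * r + 1)) := by
  have h1 : 0 ≤ r * (b * ρ - β * (k + r)) ^ 2 := by positivity
  have h2 : 0 < β ^ 2 * ((k + r) * (k + 2 * r + 1)) := by positivity
  linarith

/-- **CONJECTURE R at the vertex (1,0), T′ = 2.**  The operator Hurwitz matrix (doubled kernel: rows
`2k ↦ W(k,·)`, `2k+1 ↦ C(k,·)`, `C(k,l) = W(k+1,l) - W(k,l-1)`) of the ordered product `W = (Θ_b + r)(βD + ρ)`
(`κ₀(k) = ρ(k+r)`, `κ₁(k) = k(β(k+r) + bρ)`, `κ₂(k) = bβk(k-1)`) is totally nonnegative for `b, β, r, ρ > 0`. -/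
theorem neutralClassical_hurwitz_tn (b β r ρ : ℝ) (hb : 0 < b) (hβ : 0 < β) (hr : 0 < r) (hρ : 0 < ρ)
    (κ₀ κ₁ κ₂ : ℕ → ℝ)
    (hκ₀ : ∀ k : ℕ, κ₀ k = ρ * ((k : ℝ) + r))
    (hκ₁ : ∀ k : ℕ, κ₁ k = (k : ℝ) * (β * ((k : ℝ) + r) + b * ρ))
    (hκ₂ : ∀ k : ℕ, κ₂ k = b * β * ((k : ℝ) * (k - 1)))
    {m : ℕ} (r' c : Fin m → ℕ) (hr' : StrictMono r') (hc : StrictMono c) :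
    0 ≤ (Matrix.of fun i j =>
      if r' i % 2 = 0 then
        (if c j = r' i / 2 then κ₀ (r' i / 2) else if c j + 1 = r' i / 2 then κ₁ (r' i / 2)
          else if c j + 2 = r' i / 2 then κ₂ (r' i / 2) else 0)
      else
        (if c j = r' i / 2 + 1 then κ₀ (r' i / 2 + 1) - κ₀ (r' i / 2)
          else if c j = r' i / 2 then κ₁ (r' i / 2 + 1) - κ₁ (r' i / 2)
          else if c j + 1 = r' i / 2 then κ₂ (r' i / 2 + 1) - κ₂ (r' i / 2) else 0)).det := by
  -- lifting row identities to the doubled index (cf. `HurwitzPair.interleave_step`, whose module has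
  -- no farm olean at the time of writing; restated locally)
  have interleave_step : ∀ (X Y X' Y' : ℕ → ℕ → ℝ) (eE eO : ℕ → ℝ),
      (∀ l, X 0 l = X' 0 l) → (∀ k l, X (k + 1) l = X' (k + 1) l + eE (k + 1) * Y' k l) →
      (∀ k l, Y k l = Y' k l + eO k * X' k l) → eE 0 = 0 → ∀ t l : ℕ,
      (if t % 2 = 0 then X (t / 2) l else Y (t / 2) l) =
        (if t % 2 = 0 then X' (t / 2) l else Y' (t / 2) l)
          + (if t % 2 = 0 then eE (t / 2) else eO (t / 2))
            * (if (t - 1) % 2 = 0 then X' ((t - 1) / 2) l else Y' ((t - 1) / 2) l) := by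
    intro X Y X' Y' eE eO h0 hE hO heE0 t l
    rcases Nat.even_or_odd' t with ⟨k, rfl | rfl⟩
    · have h1 : (2 * k) % 2 = 0 := by omega
      have h2 : (2 * k) / 2 = k := by omega
      rw [if_pos h1, if_pos h1, if_pos h1, h2]
      rcases k with _ | k
      · rw [heE0, zero_mul, add_zero]; exact h0 l
      · have h4 : (2 * (k + 1) - 1) / 2 = k := by omega
        rw [if_neg (by omega), h4]
        exact hE k l
    · have h2 : (2 * k + 1) / 2 = k := by omega
      have h3 : (2 * k + 1 - 1) % 2 = 0 := by omega
      have h4 : (2 * k + 1 - 1) / 2 = k := by omega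
      rw [if_neg (by omega), if_neg (by omega), if_neg (by omega), if_pos h3, h2, h4]
      exact hO k l
  -- the constant K = κ₁ 1 = β₁ r₂ + β₂ (1 + r₁)
  set K : ℝ := b * ρ + β * (1 + r) with hKdef
  have hK : 0 < K := by positivity
  have hKne : K ≠ 0 := hK.ne'
  -- differences of the bands
  have hΔ0 : ∀ k : ℕ, κ₀ (k + 1) - κ₀ k = ρ := by
    intro k; rw [hκ₀, hκ₀]; push_cast; ring
  have hΔ1 : ∀ k : ℕ, κ₁ (k + 1) - κ₁ k = b * ρ + β * (2 * k + 1 + r) := by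
    intro k; rw [hκ₁, hκ₁]; push_cast; ring
  have hΔ2 : ∀ k : ℕ, κ₂ (k + 1) - κ₂ k = 2 * b * β * k := by
    intro k; rw [hκ₂, hκ₂]; push_cast; ring
  have hκ₀0 : κ₀ 0 = r * ρ := by rw [hκ₀]; push_cast; ring
  have hΔ0pos : ∀ k : ℕ, 0 < κ₀ (k + 1) - κ₀ k := fun k => by rw [hΔ0]; positivity
  -- stage data (memo §3): the local positive pair (F_k, G_k) in elimination form
  let D0 : ℕ → ℝ := fun k => κ₀ (k + 1) - κ₀ k
  let a1lo : ℕ → ℝ := fun k => (k : ℝ) * K / 2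
  let a1hi : ℕ → ℝ := fun k => ρ * ((k : ℝ) + 2 * r) / 2
  let μB1 : ℕ → ℝ := fun k => if k = 0 then 0 else 4 * b * β / K
  let 𝒞 : ℕ → ℝ := fun k => (κ₁ (k + 1) - κ₁ k) - μB1 k * a1hi k
  let μA2 : ℕ → ℝ := fun k => if k = 0 then 0 else a1lo k / 𝒞 (k - 1)
  let ŵ : ℕ → ℝ := fun k => a1hi k - μA2 k * D0 (k - 1)
  -- unfolding facts for the stage data
  have hD0 : ∀ k, D0 k = κ₀ (k + 1) - κ₀ k := fun k => rfl
  have ha1lo_def : ∀ k, a1lo k = (k : ℝ) * K / 2 := fun k => rfl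
  have ha1hi_def : ∀ k, a1hi k = ρ * ((k : ℝ) + 2 * r) / 2 := fun k => rfl
  have μB1_0 : μB1 0 = 0 := if_pos rfl
  have μB1_ne : ∀ k, k ≠ 0 → μB1 k = 4 * b * β / K := fun k hk => if_neg hk
  have h𝒞def : ∀ k, 𝒞 k = (κ₁ (k + 1) - κ₁ k) - μB1 k * a1hi k := fun k => rfl
  have μA2_0 : μA2 0 = 0 := if_pos rfl
  have μA2_ne : ∀ k, k ≠ 0 → μA2 k = a1lo k / 𝒞 (k - 1) := fun k hk => if_neg hk
  have hŵdef : ∀ k, ŵ k = a1hi k - μA2 k * D0 (k - 1) := fun k => rfl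
  -- positivity of the pivots
  have ha1lo : ∀ k, 0 ≤ a1lo k := fun k => by rw [ha1lo_def]; positivity
  have hμB1nn : ∀ k, 0 ≤ μB1 k := by
    intro k
    by_cases h0 : k = 0
    · rw [h0, μB1_0]
    · rw [μB1_ne k h0]; positivity
  -- 𝒞 in closed form
  have h𝒞0 : 𝒞 0 = K := by
    rw [h𝒞def, μB1_0, zero_mul, sub_zero, hΔ1, hKdef]; push_cast; ring
  have h𝒞ge1 : ∀ k : ℕ, 1 ≤ k → 𝒞 k = (2 * β ^ 2 * (r + 1) * k
      + (b * ρ - β * (r + 1)) ^ 2 + 4 * b * β * ρ) / K := by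
    intro k hk
    rw [h𝒞def, μB1_ne k (by omega), ha1hi_def, hΔ1, hKdef]
    field_simp
    ring
  have hN𝒞pos : ∀ k : ℕ, 0 < 2 * β ^ 2 * (r + 1) * (k : ℝ)
      + (b * ρ - β * (r + 1)) ^ 2 + 4 * b * β * ρ := fun k => by positivity
  have h𝒞pos : ∀ k, 0 < 𝒞 k := by
    intro k
    rcases Nat.eq_zero_or_pos k with rfl | hk
    · rw [h𝒞0]; exact hK
    · rw [h𝒞ge1 k hk]; exact div_pos (hN𝒞pos k) hK
  have hμA2nn : ∀ k, 0 ≤ μA2 k := by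
    intro k
    by_cases h0 : k = 0
    · rw [h0, μA2_0]
    · rw [μA2_ne k h0]; exact div_nonneg (ha1lo k) (h𝒞pos _).le
  -- ŵ: small values and the closed form ŵ(k+1)·K𝒞(k) = r₂·𝒫₂(k)
  have hŵ0 : ŵ 0 = r * ρ := by
    rw [hŵdef, μA2_0, zero_mul, sub_zero, ha1hi_def]; push_cast; ring
  have hŵ1 : ŵ 1 = r * ρ := by
    rw [hŵdef, μA2_ne 1 one_ne_zero, ha1lo_def, ha1hi_def, Nat.sub_self, h𝒞0, hD0, hΔ0]
    push_cast
    field_simp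
    ring
  have hŵge2 : ∀ k : ℕ, 1 ≤ k → ŵ (k + 1) * (2 * β ^ 2 * (r + 1) * (k : ℝ)
      + (b * ρ - β * (r + 1)) ^ 2 + 4 * b * β * ρ)
      = ρ * (r * (b * ρ - β * (k + r)) ^ 2 + β ^ 2 * (((k : ℝ) + r) * (k + 2 * r + 1))) := by
    intro k hk
    rw [hŵdef, μA2_ne (k + 1) (by omega), ha1lo_def, ha1hi_def, Nat.add_sub_cancel, h𝒞ge1 k hk,
      hD0, hΔ0, hKdef]
    push_cast
    have hden : 2 * β ^ 2 * (r + 1) * (k : ℝ)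
      + (b * ρ - β * (r + 1)) ^ 2 + 4 * b * β * ρ ≠ 0 := (hN𝒞pos k).ne'
    have hKne' : b * ρ + β * (1 + r) ≠ 0 := by rw [← hKdef]; exact hKne
    field_simp
    ring
  have hŵpos : ∀ k, 0 < ŵ k := by
    intro k
    rcases Nat.lt_or_ge k 2 with hk | hk
    · interval_cases k
      · rw [hŵ0]; positivity
      · rw [hŵ1]; positivity
    · obtain ⟨j, rfl⟩ : ∃ j, k = j + 2 := ⟨k - 2, by omega⟩
      have hj1 : 1 ≤ j + 1 := by omega
      have hpos := keyPivot_pos b β r ρ ((j + 1 : ℕ) : ℝ) hβ hr (by positivity)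
      have hid := hŵge2 (j + 1) hj1
      have hprod : 0 < ŵ (j + 1 + 1) * (2 * β ^ 2 * (r + 1) * ((j + 1 : ℕ) : ℝ)
          + (b * ρ - β * (r + 1)) ^ 2 + 4 * b * β * ρ) := by
        rw [hid]; exact mul_pos hρ hpos
      exact pos_of_mul_pos_left hprod (hN𝒞pos (j + 1)).le
  -- the row kernels of the five stages
  let rowW : ℕ → ℕ → ℝ := fun k l =>
    if l = k then κ₀ k else if l + 1 = k then κ₁ k else if l + 2 = k then κ₂ k else 0
  let rowC : ℕ → ℕ → ℝ := fun k l =>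
    if l = k + 1 then κ₀ (k + 1) - κ₀ k else if l = k then κ₁ (k + 1) - κ₁ k
      else if l + 1 = k then κ₂ (k + 1) - κ₂ k else 0
  let A1 : ℕ → ℕ → ℝ := fun k l => if l = k then a1hi k else if l + 1 = k then a1lo k else 0
  let B1 : ℕ → ℕ → ℝ := fun k l => if l = k then 𝒞 k else if l = k + 1 then D0 k else 0
  let A2 : ℕ → ℕ → ℝ := fun k l => if l = k then ŵ k else 0
  let B2 : ℕ → ℕ → ℝ := fun k l => if l = k + 1 then D0 k else 0
  let A3 : ℕ → ℕ → ℝ := fun k l => if k = 0 ∧ l = 0 then r * ρ else 0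
  -- stage identities, row by row
  have I1zero : ∀ l, rowW 0 l = A1 0 l := by
    intro l; simp only [rowW, A1, ha1hi_def, hκ₀0]
    split_ifs <;> first | (exfalso; omega) | (push_cast; ring)
  have I1E : ∀ k l, rowW (k + 1) l = A1 (k + 1) l + (((k + 1 : ℕ) : ℝ) / 2) * rowC k l := by
    intro k l
    simp only [rowW, rowC, A1, ha1hi_def, ha1lo_def]
    split_ifs <;> first | (exfalso; omega) | skip
    · rw [hΔ0, hκ₀]; push_cast; ring
    · rw [hΔ1, hκ₁, hKdef]; push_cast; ring
    · rw [hΔ2, hκ₂]; push_cast; ring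
    · ring
  have I2 : ∀ k l, rowC k l = B1 k l + μB1 k * A1 k l := by
    intro k l
    simp only [rowC, B1, A1]
    split_ifs <;> first | (exfalso; omega) | skip
    · ring
    · simp only [𝒞]; ring
    · have hk : k ≠ 0 := by omega
      simp only [μB1, if_neg hk]
      rw [zero_add, hΔ2, ha1lo_def, hKdef]
      field_simp
      ring
    · ring
  have I3zero : ∀ l, A1 0 l = A2 0 l := by
    intro l; simp only [A1, A2, ha1hi_def, hŵ0]
    split_ifs <;> first | (exfalso; omega) | (push_cast; ring)
  have I3E : ∀ k l, A1 (k + 1) l = A2 (k + 1) l + μA2 (k + 1) * B1 k l := by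
    intro k l
    simp only [A1, A2, B1]
    split_ifs <;> first | (exfalso; omega) | skip
    · simp only [ŵ, Nat.add_sub_cancel]; ring
    · simp only [μA2, if_neg (show k + 1 ≠ 0 by omega), Nat.add_sub_cancel]
      rw [zero_add, div_mul_cancel₀ _ (h𝒞pos k).ne']
    · ring
  have I4 : ∀ k l, B1 k l = B2 k l + (𝒞 k / ŵ k) * A2 k l := by
    intro k l
    simp only [B1, B2, A2]
    split_ifs <;> first | (exfalso; omega) | skip
    · rw [zero_add, div_mul_cancel₀ _ (hŵpos k).ne']
    · ring
    · ring
  have I5zero : ∀ l, A2 0 l = A3 0 l := by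
    intro l; simp only [A2, A3, hŵ0, true_and]
  have I5E : ∀ k l, A2 (k + 1) l = A3 (k + 1) l + (ŵ (k + 1) / D0 k) * B2 k l := by
    intro k l
    simp only [A2, A3, B2, if_neg (show ¬ (k + 1 = 0 ∧ l = 0) by omega), zero_add]
    split_ifs
    · rw [div_mul_cancel₀ _ (hΔ0pos k).ne']
    · rw [mul_zero]
  -- total nonnegativity, stage by stage (from U = (A3 | B2) back to (rowW | rowC))
  let R5 : ℕ → ℕ → ℝ := fun t l => if t % 2 = 0 then A3 (t / 2) l else B2 (t / 2) l
  let R4 : ℕ → ℕ → ℝ := fun t l => if t % 2 = 0 then A2 (t / 2) l else B2 (t / 2) l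
  let R3 : ℕ → ℕ → ℝ := fun t l => if t % 2 = 0 then A2 (t / 2) l else B1 (t / 2) l
  let R2 : ℕ → ℕ → ℝ := fun t l => if t % 2 = 0 then A1 (t / 2) l else B1 (t / 2) l
  let R1 : ℕ → ℕ → ℝ := fun t l => if t % 2 = 0 then A1 (t / 2) l else rowC (t / 2) l
  let e5 : ℕ → ℝ := fun t => if t % 2 = 0 then (if t / 2 = 0 then 0 else ŵ (t / 2) / D0 (t / 2 - 1)) else 0
  let e4 : ℕ → ℝ := fun t => if t % 2 = 0 then 0 else 𝒞 (t / 2) / ŵ (t / 2)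
  let e3 : ℕ → ℝ := fun t => if t % 2 = 0 then μA2 (t / 2) else 0
  let e2 : ℕ → ℝ := fun t => if t % 2 = 0 then 0 else μB1 (t / 2)
  let e1 : ℕ → ℝ := fun t => if t % 2 = 0 then ((t / 2 : ℕ) : ℝ) / 2 else 0
  have T5 : ∀ (k' : ℕ) (r' c' : Fin k' → ℕ), StrictMono r' → StrictMono c' →
      0 ≤ (Matrix.of fun i j => R5 (r' i) (c' j)).det := by
    intro k' r' c' hr' hc'
    refine StairTN.stairs_minor_nonneg R5 (fun t => (t + 1) / 2) (fun t => (t + 1) / 2)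
      (fun _ => le_rfl) (fun t => by omega) ?_ ?_ ?_ r' c' hr' hc'
    · intro t l
      show 0 ≤ (if t % 2 = 0 then A3 (t / 2) l else B2 (t / 2) l)
      by_cases h : t % 2 = 0
      · rw [if_pos h]; show 0 ≤ (if t / 2 = 0 ∧ l = 0 then r * ρ else 0); split_ifs
        · positivity
        · exact le_rfl
      · rw [if_neg h]; show 0 ≤ (if l = t / 2 + 1 then D0 (t / 2) else 0); split_ifs
        · exact (hΔ0pos _).le
        · exact le_rfl
    · intro t l hl
      show (if t % 2 = 0 then A3 (t / 2) l else B2 (t / 2) l) = 0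
      by_cases h : t % 2 = 0
      · rw [if_pos h]; exact if_neg (by omega)
      · rw [if_neg h]; exact if_neg (by omega)
    · intro t l hl
      show (if t % 2 = 0 then A3 (t / 2) l else B2 (t / 2) l) = 0
      by_cases h : t % 2 = 0
      · rw [if_pos h]; exact if_neg (by omega)
      · rw [if_neg h]; exact if_neg (by omega)
  have T4 : ∀ (k' : ℕ) (r' c' : Fin k' → ℕ), StrictMono r' → StrictMono c' →
      0 ≤ (Matrix.of fun i j => R4 (r' i) (c' j)).det := by
    intro k' r' c' hr' hc'
    have heq : (Matrix.of fun i j => R4 (r' i) (c' j)) =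
        Matrix.of fun i j => R5 (r' i) (c' j) + e5 (r' i) * R5 (r' i - 1) (c' j) := by
      ext i j
      exact interleave_step A2 B2 A3 B2 (fun k => if k = 0 then 0 else ŵ k / D0 (k - 1)) (fun _ => 0)
        I5zero (fun k l => by rw [if_neg (by omega), Nat.add_sub_cancel]; exact I5E k l)
        (fun k l => by ring) (if_pos rfl) (r' i) (c' j)
    rw [heq]
    refine HurwitzPair.step_tn R5 e5 (fun t => ?_) ?_ T5 r' c' hr' hc'
    · show 0 ≤ (if t % 2 = 0 then (if t / 2 = 0 then 0 else ŵ (t / 2) / D0 (t / 2 - 1)) else 0)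
      split_ifs
      · exact le_rfl
      · exact div_nonneg (hŵpos _).le (hΔ0pos _).le
      · exact le_rfl
    · show (if 0 % 2 = 0 then (if 0 / 2 = 0 then (0:ℝ) else ŵ (0 / 2) / D0 (0 / 2 - 1)) else 0) = 0
      rw [if_pos rfl, if_pos rfl]
  have T3 : ∀ (k' : ℕ) (r' c' : Fin k' → ℕ), StrictMono r' → StrictMono c' →
      0 ≤ (Matrix.of fun i j => R3 (r' i) (c' j)).det := by
    intro k' r' c' hr' hc'
    have heq : (Matrix.of fun i j => R3 (r' i) (c' j)) =
        Matrix.of fun i j => R4 (r' i) (c' j) + e4 (r' i) * R4 (r' i - 1) (c' j) := by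
      ext i j
      exact interleave_step A2 B1 A2 B2 (fun _ => 0) (fun k => 𝒞 k / ŵ k)
        (fun l => rfl) (fun k l => by ring) I4 rfl (r' i) (c' j)
    rw [heq]
    refine HurwitzPair.step_tn R4 e4 (fun t => ?_) ?_ T4 r' c' hr' hc'
    · show 0 ≤ (if t % 2 = 0 then (0:ℝ) else 𝒞 (t / 2) / ŵ (t / 2))
      split_ifs
      · exact le_rfl
      · exact div_nonneg (h𝒞pos _).le (hŵpos _).le
    · exact if_pos rfl
  have T2 : ∀ (k' : ℕ) (r' c' : Fin k' → ℕ), StrictMono r' → StrictMono c' →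
      0 ≤ (Matrix.of fun i j => R2 (r' i) (c' j)).det := by
    intro k' r' c' hr' hc'
    have heq : (Matrix.of fun i j => R2 (r' i) (c' j)) =
        Matrix.of fun i j => R3 (r' i) (c' j) + e3 (r' i) * R3 (r' i - 1) (c' j) := by
      ext i j
      exact interleave_step A1 B1 A2 B1 μA2 (fun _ => 0) I3zero I3E (fun k l => by ring) μA2_0 (r' i) (c' j)
    rw [heq]
    refine HurwitzPair.step_tn R3 e3 (fun t => ?_) ?_ T3 r' c' hr' hc'
    · show 0 ≤ (if t % 2 = 0 then μA2 (t / 2) else 0)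
      split_ifs
      · exact hμA2nn _
      · exact le_rfl
    · show (if 0 % 2 = 0 then μA2 (0 / 2) else 0) = 0
      rw [if_pos rfl]; exact μA2_0
  have T1 : ∀ (k' : ℕ) (r' c' : Fin k' → ℕ), StrictMono r' → StrictMono c' →
      0 ≤ (Matrix.of fun i j => R1 (r' i) (c' j)).det := by
    intro k' r' c' hr' hc'
    have heq : (Matrix.of fun i j => R1 (r' i) (c' j)) =
        Matrix.of fun i j => R2 (r' i) (c' j) + e2 (r' i) * R2 (r' i - 1) (c' j) := by
      ext i j
      exact interleave_step A1 rowC A1 B1 (fun _ => 0) μB1 (fun l => rfl) (fun k l => by ring) I2 rfl (r' i) (c' j)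
    rw [heq]
    refine HurwitzPair.step_tn R2 e2 (fun t => ?_) ?_ T2 r' c' hr' hc'
    · show 0 ≤ (if t % 2 = 0 then (0:ℝ) else μB1 (t / 2))
      split_ifs
      · exact le_rfl
      · exact hμB1nn _
    · exact if_pos rfl
  -- the last stage: (rowW | rowC) = E₁ · (A1 | rowC)
  have heq : (Matrix.of fun i j =>
      if r' i % 2 = 0 then
        (if c j = r' i / 2 then κ₀ (r' i / 2) else if c j + 1 = r' i / 2 then κ₁ (r' i / 2)
          else if c j + 2 = r' i / 2 then κ₂ (r' i / 2) else 0)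
      else
        (if c j = r' i / 2 + 1 then κ₀ (r' i / 2 + 1) - κ₀ (r' i / 2)
          else if c j = r' i / 2 then κ₁ (r' i / 2 + 1) - κ₁ (r' i / 2)
          else if c j + 1 = r' i / 2 then κ₂ (r' i / 2 + 1) - κ₂ (r' i / 2) else 0)) =
      Matrix.of fun i j => R1 (r' i) (c j) + e1 (r' i) * R1 (r' i - 1) (c j) := by
    ext i j
    exact interleave_step rowW rowC A1 rowC (fun k => ((k : ℕ) : ℝ) / 2) (fun _ => 0)
      I1zero I1E (fun k l => by ring) (by simp) (r' i) (c j)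
  rw [heq]
  refine HurwitzPair.step_tn R1 e1 (fun t => ?_) ?_ T1 r' c hr' hc
  · show 0 ≤ (if t % 2 = 0 then ((t / 2 : ℕ) : ℝ) / 2 else 0)
    split_ifs
    · positivity
    · exact le_rfl
  · show (if 0 % 2 = 0 then ((0 / 2 : ℕ) : ℝ) / 2 else 0) = 0
    rw [if_pos rfl]; simp

end NeutralClassical

end Summit.CriticalPhenomena.PercolationContinuityZ3.Theorems
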